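import Literature.NumberTheory.EllipticCurves.DeligneSerreRankinProp55Proofs
import Literature.NumberTheory.EllipticCurves.ModularFormsGamma1PlusMinus
import HarnessLib

/-!
# Deligne–Serre 1974, Prop. 5.5, level by level: no weight-one cusp forms of level `N ≤ 4`,
# and Prop. 5.5 from (2.7.2) / the Eichler–Shimura rank count at the levels `N ≥ 5` only

A proofs-only continuation of `DeligneSerreRankinProp55Proofs` (theorems only; no definition, no
named fact, nothing restated; D-0026).  There the named fact
`Literature.NumberTheory.EllipticCurves.ModularForms.DeligneSerre1974.prop55` (Deligne–Serre 1974,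
Prop. 5.5) was reduced to the spanning statement (2.7.2) `DeligneSerre1974_span_integralLattice1 N k`
— and through Shimura's (3.5.20)/Thm. 3.52 to the rank half of the Eichler–Shimura isomorphism for
`Γ₁(N)` (`prop55_of_periodLatticeK1_eq_span`) — **at every level `N ≥ 1`**.  The tree's route to
that rank count (`ManinSymbolsWeightK`: no elliptic elements and `-1 ∉ Γ`, i.e. `Γ₁(N)`, `N ≥ 4`;
`ModularFormsGamma1Dimension` / `…OddDimension`: the dimension bound for `N ≥ 5`) delivers it for
`N ≥ 5`.  This file removes the small levels from the hypothesis, using two observations: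

1. `cuspForm_gamma1_weight_one_eq_zero_of_le_four` — **`S₁(Γ₁(N)) = 0` for `N ≤ 4`**: for such `N`
   every unit of `ℤ/Nℤ` is `±1`, so `Γ₀(N) = ±Γ₁(N)` (`gamma0_le_gamma1pm_of_le_four`); hence for
   `f ∈ S₁(Γ₁(N))` the square `f²` is a weight-`2` cusp form on `Γ₀(N)` (`f² ∣₂ (-γ) = f² ∣₂ γ`),
   and `S₂(Γ₀(N)) = 0` for `N ≤ 10` (`cuspForm_two_gamma0_eq_zero_of_le_ten`, genus `0`), so
   `f² = 0` and `f = 0`.  Prop. 5.5 (whose `f` is non-zero of weight `1`) is therefore vacuous at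
   the levels `N ≤ 4`.
2. The proofs of (2.7.3), (2.7.4) from (2.7.2) (`prop27_eigenvalues_of_span_integralLattice1`,
   `prop27_conj_of_span_integralLattice1`, `DeligneSerreProp27Proofs`) and of Prop. 5.5 from them
   (`prop55_of`, `DeligneSerreRankinProofs`) use (2.7.2) only **at the level and weight of the given
   form**.  They are repeated here in that level-local form
   (`exists_numberField_of_span_integralLattice1`, `exists_conj_eigenform_of_span_integralLattice1`,
   `prop55_at_of_span_integralLattice1_one`), with the same arguments (Deligne–Serre p. 512 and
   p. 520).

Assembly (`prop51` being the theorem `prop51_holds`):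

* `prop55_of_span_integralLattice1_one_of_five_le` — Prop. 5.5 from (2.7.2) in weight `1` at every
  level `N ≥ 5`;
* `prop55_of_span_integralLattice1_of_le_of_five_le` — from (2.7.2) at every level `N ≥ 5` in all
  weights `k ≥ K₀(N)` (division by `E₄`, `E₆`: `DeligneSerre1974_span_integralLattice1.of_forall_le`,
  `.weight_one_of_five_seven`);
* `prop55_of_heckeStableRealLattice_of_five_le` — from a full Hecke-stable real lattice in
  `S_{n+2}(Γ₁(N))^∨` for every `N ≥ 5` and all large `n` (Shimura Thm. 3.52,
  `DeligneSerre1974_span_integralLattice1_of_heckeStableRealLattice`);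
* **`prop55_of_periodLatticeK1_eq_span_of_five_le`** — from the rank half of Eichler–Shimura for
  `Γ₁(N)`, **`N ≥ 5` only**, in all large weights: `periodLatticeK1 n` is the `ℤ`-span of
  `2 dim_ℂ S_{n+2}(Γ₁(N))` functionals (then it is a full Hecke-stable real lattice for `n ≥ 5` by
  `heckeStableRealLatticeOfGenerators`, `EichlerShimuraPeriodsGamma1RealSpanProofs`).

So `prop55_holds` is `prop55_of_periodLatticeK1_eq_span_of_five_le H` for a proof `H` of the rank
count at the levels `N ≥ 5` (Shimura 1971, Thm. 8.4 with (8.2.23) for `Γ₁(N)`).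

## References

* P. Deligne, J.-P. Serre, *Formes modulaires de poids 1*, Ann. Sci. ÉNS (4) 7 (1974), 507–530:
  Prop. 2.7 and Rem. 2.8 (p. 512), Prop. 5.1, (5.4.1), Prop. 5.5 (pp. 518–520).
  [DeligneSerreASENS1974]
* G. Shimura, *Introduction to the arithmetic theory of automorphic functions*, Publ. Math. Soc.
  Japan 11 (1971): (3.5.20), Thm. 3.48, Thm. 3.52, Thm. 8.4.
* F. Diamond, J. Shurman, *A first course in modular forms*, GTM 228 (2005): Thm. 3.5.1 and
  Fig. 3.3 (`g(X₀(N)) = 0` for `N ≤ 10`), §3.9 (`S₁(Γ₁(N))`).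
-/

noncomputable section

open scoped MatrixGroups ModularForm Topology

open CongruenceSubgroup Filter UpperHalfPlane

namespace Literature.NumberTheory.EllipticCurves.ModularForms

/-! ### No weight-one cusp forms of level `N ≤ 4` -/

section SmallLevel

variable {N : ℕ} [NeZero N]

/-- For `N ≤ 4` every unit of `ℤ/Nℤ` is `±1`, so **`Γ₀(N) ≤ ±Γ₁(N)`** (hence `Γ₀(N) = ±Γ₁(N)`).
[folklore] -/
theorem gamma0_le_gamma1pm_of_le_four (hN : N ≤ 4) : Gamma0 N ≤ Gamma1pm N := by
  have hunits : ∀ a d : ZMod N, a * d = 1 → d = 1 ∨ d = -1 := by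
    have h0 : 0 < N := Nat.pos_of_ne_zero (NeZero.ne N)
    interval_cases N <;> decide
  intro γ hγ
  rw [Gamma0_mem] at hγ
  rw [mem_gamma1pm_iff]
  refine ⟨hγ, hunits (((γ 0 0 : ℤ) : ZMod N)) _ ?_⟩
  have hdet : (γ 0 0 : ℤ) * γ 1 1 - γ 0 1 * γ 1 0 = 1 := by
    have := Matrix.SpecialLinearGroup.det_coe γ
    rwa [Matrix.det_fin_two] at this
  have hdet' : ((γ 0 0 : ℤ) : ZMod N) * ((γ 1 1 : ℤ) : ZMod N) -
      ((γ 0 1 : ℤ) : ZMod N) * ((γ 1 0 : ℤ) : ZMod N) = 1 := by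
    exact_mod_cast congrArg ((↑) : ℤ → ZMod N) hdet
  rw [hγ, mul_zero, sub_zero] at hdet'
  exact hdet'

/-- The square of a weight-one cusp form on `Γ₁(N)`, `N ≤ 4`, is a weight-two cusp form on
`Γ₀(N) = ±Γ₁(N)` (in even weight `F ∣₂ (-γ) = F ∣₂ γ`). [folklore] -/
theorem exists_cuspForm_gamma0_two_coe_eq_mul_self (hN : N ≤ 4) (f : CuspForm (Gamma1 N) 1) :
    ∃ F : CuspForm (Gamma0 N) 2, (⇑F : ℍ → ℂ) = ⇑f * ⇑f := by
  have hle := gamma0_le_gamma1pm_of_le_four hN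
  have key : ∀ δ ∈ Gamma1 N, ((⇑f : ℍ → ℂ) * ⇑f) ∣[(2 : ℤ)] δ = ⇑f * ⇑f := fun δ hδ ↦ by
    have h : (⇑f : ℍ → ℂ) ∣[(1 : ℤ)] δ = ⇑f :=
      SlashInvariantForm.slash_action_eqn f _ ⟨δ, hδ, rfl⟩
    rw [show (2 : ℤ) = 1 + 1 by norm_num, ModularForm.mul_slash_SL2, h]
  have hinv : ∀ γ ∈ Gamma0 N, ((⇑f : ℍ → ℂ) * ⇑f) ∣[(2 : ℤ)] γ = ⇑f * ⇑f := fun γ hγ ↦ by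
    rcases hle hγ with h | h
    · exact key γ h
    · rw [← slash_neg_of_even (by decide) _ γ]
      exact key (-γ) h
  refine ⟨{ toFun := (⇑f : ℍ → ℂ) * ⇑f
            slash_action_eq' := by
              rintro _ ⟨γ, hγ, rfl⟩
              exact hinv γ hγ
            holo' := f.holo'.mul f.holo'
            zero_at_cusps' := fun {c} hc ↦ by
              rw [Subgroup.IsArithmetic.isCusp_iff_isCusp_SL2Z] at hc
              rw [OnePoint.isZeroAt_iff_forall_SL2Z hc]
              intro γ hγ
              have hc1 : IsCusp c (Gamma1 N : Subgroup (GL (Fin 2) ℝ)) :=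
                (Subgroup.IsArithmetic.isCusp_iff_isCusp_SL2Z _).mpr hc
              have h1 : IsZeroAtImInfty ((⇑f : ℍ → ℂ) ∣[(1 : ℤ)] γ) :=
                (OnePoint.isZeroAt_iff_forall_SL2Z hc).mp (CuspFormClass.zero_at_cusps f hc1) γ hγ
              rw [show (2 : ℤ) = 1 + 1 by norm_num, ModularForm.mul_slash_SL2]
              have h2 := h1.mul h1
              rw [mul_zero] at h2
              exact h2 }, rfl⟩

/-- **There are no weight-one cusp forms of level `N ≤ 4`: `S₁(Γ₁(N)) = 0`** (`f²` is a weight-two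
cusp form on `Γ₀(N)`, and `S₂(Γ₀(N)) = 0`, `X₀(N)` having genus `0`; Diamond–Shurman Thm. 3.5.1,
Fig. 3.3, §3.9). [cite: DiamondShurman2005, Thm. 3.5.1 and Fig. 3.3] -/
theorem cuspForm_gamma1_weight_one_eq_zero_of_le_four (hN : N ≤ 4) (f : CuspForm (Gamma1 N) 1) :
    f = 0 := by
  obtain ⟨F, hF⟩ := exists_cuspForm_gamma0_two_coe_eq_mul_self hN f
  have hF0 : F = 0 := cuspForm_two_gamma0_eq_zero_of_le_ten (by omega) F
  have hff : (⇑f : ℍ → ℂ) * ⇑f = 0 := by rw [← hF, hF0]; rfl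
  refine CuspForm.ext fun τ ↦ ?_
  have hτ := congr_fun hff τ
  simp only [Pi.mul_apply, Pi.zero_apply, mul_self_eq_zero] at hτ
  rw [hτ, CuspForm.zero_apply]

end SmallLevel

namespace DeligneSerre1974

variable {N : ℕ} [NeZero N] {k : ℤ}

/-! ### (2.7.3) and (2.7.4) at one level and weight, from (2.7.2) there -/

/-- **Deligne–Serre (2.7.1)–(2.7.3) at level `N` and weight `k`, from (2.7.2) at `(N, k)`**: for a
non-zero cusp form `f` of type `(k, ε)` on `Γ₀(N)`, eigen for the `T_p`, `p ∤ N`, the eigenvalues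
`a_p` are algebraic integers lying in a finite extension of `ℚ` (the level-local form of
`prop27_eigenvalues_of_span_integralLattice1`, same proof).
[cite: DeligneSerreASENS1974, Prop. 2.7 (2.7.1)–(2.7.3)] -/
theorem exists_numberField_of_span_integralLattice1 (hL : DeligneSerre1974_span_integralLattice1 N k)
    (ε : DirichletCharacter ℂ N) (f : CuspForm (Gamma1 N) k) (hfε : f ∈ nebentypusSubspace N k ε)
    (hf0 : f ≠ 0)
    (heig : ∀ p : ℕ, (hp : p.Prime) → ¬ p ∣ N →
      ∃ a : ℂ, (haveI : NeZero p := ⟨hp.ne_zero⟩; heckeT (Gamma1 N) k p f) = a • f) :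
    ∃ K : IntermediateField ℚ ℂ, FiniteDimensional ℚ K ∧
      ∀ p : ℕ, p.Prime → ¬ p ∣ N → heckeEigenvalue f p ∈ K ∧ IsIntegral ℤ (heckeEigenvalue f p) := by
  have _ := hfε
  rcases le_or_gt k 0 with hk | hk
  · exact absurd (cuspForm_eq_zero_of_weight_nonpos hk f) hf0
  have hk1 : (1 : ℤ) ≤ k := hk
  obtain ⟨K', hK'fg, hK'⟩ := exists_fg_subalgebra_of_span_integralLattice1 hL hk1 hf0
  set S : Set ℂ := {a | ∃ p : ℕ, p.Prime ∧ ¬ p ∣ N ∧ a = heckeEigenvalue f p} with hS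
  have hSK' : S ⊆ K' := by
    rintro _ ⟨p, hp, hpN, rfl⟩
    haveI : NeZero p := ⟨hp.ne_zero⟩
    exact hK' _ _ (fun x hx ↦ heckeT_mem_integralLattice1 hk1 hx p hp)
      (heckeT_eq_heckeEigenvalue_smul f p (heig p hp hpN))
  refine ⟨IntermediateField.adjoin ℚ S,
    finiteDimensional_of_le_adjoin_of_subset_fg_subalgebra K' hK'fg hSK' _ le_rfl,
    fun p hp hpN ↦ ⟨IntermediateField.subset_adjoin ℚ S ⟨p, hp, hpN, rfl⟩, ?_⟩⟩
  haveI : NeZero p := ⟨hp.ne_zero⟩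
  exact isIntegral_of_heckeT_gamma1_apply_eq_smul hL hk1 hp hf0
    (heckeT_eq_heckeEigenvalue_smul f p (heig p hp hpN))

/-- **Deligne–Serre (2.7.4) (conjugates of eigenforms) at level `N` and weight `k`, from (2.7.2) at
`(N, k)`**: for `f ≠ 0` of type `(k, ε)` with `T_p f = a_p f` (`p ∤ N`), a subfield `K ∋ a_p` of `ℂ`
and an embedding `τ : K → ℂ`, there is a non-zero `g` of some type `(k, ε')`, same level and weight,
with `T_p g = τ(a_p) g` for all `p ∤ N` (the level-local form of `prop27_conj_of_span_integralLattice1`,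
same proof: transport the eigenvector along an extension of `τ` in the integral basis of (2.7.2)).
[cite: DeligneSerreASENS1974, Prop. 2.7 (2.7.4)] -/
theorem exists_conj_eigenform_of_span_integralLattice1
    (hL : DeligneSerre1974_span_integralLattice1 N k)
    (ε : DirichletCharacter ℂ N) (f : CuspForm (Gamma1 N) k) (hfε : f ∈ nebentypusSubspace N k ε)
    (hf0 : f ≠ 0)
    (heig : ∀ p : ℕ, (hp : p.Prime) → ¬ p ∣ N →
      ∃ a : ℂ, (haveI : NeZero p := ⟨hp.ne_zero⟩; heckeT (Gamma1 N) k p f) = a • f)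
    (K : IntermediateField ℚ ℂ) (hK : ∀ p : ℕ, p.Prime → ¬ p ∣ N → heckeEigenvalue f p ∈ K)
    (τ : K →+* ℂ) :
    ∃ (ε' : DirichletCharacter ℂ N) (g : CuspForm (Gamma1 N) k),
      g ∈ nebentypusSubspace N k ε' ∧ g ≠ 0 ∧
      ∀ (p : ℕ) (hp : p.Prime) (hpN : ¬ p ∣ N),
        (haveI : NeZero p := ⟨hp.ne_zero⟩; heckeT (Gamma1 N) k p g) =
          τ ⟨heckeEigenvalue f p, hK p hp hpN⟩ • g := by
  classical
  rcases le_or_gt k 0 with hk | hk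
  · exact absurd (cuspForm_eq_zero_of_weight_nonpos hk f) hf0
  have hk1 : (1 : ℤ) ≤ k := hk
  have hspan := hL hk1
  have hfε' := mem_nebentypusSubspace_iff_diamondOp.mp hfε
  -- the operators `𝒯 = {T_p : p ∤ N} ∪ {⟨d⟩}` and their eigenvalues on `f`
  set 𝒯 : Set (Module.End ℂ (CuspForm (Gamma1 N) k)) :=
    {T | ∃ (p : ℕ) (hp : p.Prime), ¬ p ∣ N ∧
        T = (haveI : NeZero p := ⟨hp.ne_zero⟩; heckeT (Gamma1 N) k p)} ∪
      {T | ∃ d : (ZMod N)ˣ, T = diamondOp N k (d : ZMod N)} with h𝒯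
  have hTmem : ∀ (p : ℕ) (hp : p.Prime), ¬ p ∣ N →
      (haveI : NeZero p := ⟨hp.ne_zero⟩; heckeT (Gamma1 N) k p) ∈ 𝒯 :=
    fun p hp hpN ↦ Or.inl ⟨p, hp, hpN, rfl⟩
  have hdmem : ∀ d : (ZMod N)ˣ, diamondOp N k (d : ZMod N) ∈ 𝒯 := fun d ↦ Or.inr ⟨d, rfl⟩
  have hstab : ∀ T ∈ 𝒯, ∀ x ∈ integralLattice1 N k, T x ∈ integralLattice1 N k := by
    rintro T (⟨p, hp, hpN, rfl⟩ | ⟨d, rfl⟩) x hx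
    · haveI : NeZero p := ⟨hp.ne_zero⟩
      exact heckeT_mem_integralLattice1 hk1 hx p hp
    · exact diamondOp_mem_integralLattice1 hx d
  set lam : Module.End ℂ (CuspForm (Gamma1 N) k) → ℂ := LatticeEigen.eigenvalueOf f with hlam
  have hlam_p : ∀ (p : ℕ) (hp : p.Prime), ¬ p ∣ N →
      lam (haveI : NeZero p := ⟨hp.ne_zero⟩; heckeT (Gamma1 N) k p) = heckeEigenvalue f p := by
    intro p hp hpN
    haveI : NeZero p := ⟨hp.ne_zero⟩
    exact LatticeEigen.eigenvalueOf_eq hf0 (heckeT_eq_heckeEigenvalue_smul f p (heig p hp hpN))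
  have hlam_d : ∀ d : (ZMod N)ˣ, lam (diamondOp N k (d : ZMod N)) = ε (d : ZMod N) :=
    fun d ↦ LatticeEigen.eigenvalueOf_eq hf0 (hfε' d)
  have hlam_eig : ∀ T ∈ 𝒯, T f = lam T • f := by
    rintro T (⟨p, hp, hpN, rfl⟩ | ⟨d, rfl⟩)
    · exact LatticeEigen.apply_eq_eigenvalueOf_smul (heig p hp hpN)
    · exact LatticeEigen.apply_eq_eigenvalueOf_smul ⟨_, hfε' d⟩
  have hint : ∀ T ∈ 𝒯, IsIntegral ℤ (lam T) := by
    rintro T (⟨p, hp, hpN, rfl⟩ | ⟨d, rfl⟩)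
    · haveI : NeZero p := ⟨hp.ne_zero⟩
      exact isIntegral_of_heckeT_gamma1_apply_eq_smul hL hk1 hp hf0
        (hlam_eig _ (hTmem p hp hpN))
    · rw [hlam_d]
      exact isIntegral_dirichletCharacter_apply ε _
  -- the number field `K₁ = ℚ(λ_T : T ∈ 𝒯)` and the extension `σ` of `τ|ℚ(a_p)`
  set S : Set ℂ := lam '' 𝒯 with hS
  have hSint : ∀ s ∈ S, IsIntegral ℚ s ∧ ((minpoly ℚ s).map (algebraMap ℚ ℂ)).Splits := by
    rintro _ ⟨T, hT, rfl⟩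
    exact ⟨(hint T hT).tower_top, IsAlgClosed.splits _⟩
  set K₁ : IntermediateField ℚ ℂ := IntermediateField.adjoin ℚ S with hK₁
  have hlamK : ∀ T ∈ 𝒯, lam T ∈ K₁ := fun T hT ↦ IntermediateField.subset_adjoin ℚ S ⟨T, hT, rfl⟩
  set S₀ : Set ℂ := {a | ∃ p : ℕ, p.Prime ∧ ¬ p ∣ N ∧ a = heckeEigenvalue f p} with hS₀
  have hS₀K : S₀ ≤ (K : Set ℂ) := by
    rintro _ ⟨p, hp, hpN, rfl⟩
    exact hK p hp hpN
  have hS₀S : S₀ ⊆ S := by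
    rintro _ ⟨p, hp, hpN, rfl⟩
    exact ⟨_, hTmem p hp hpN, hlam_p p hp hpN⟩
  have hK₀K : IntermediateField.adjoin ℚ S₀ ≤ K := IntermediateField.adjoin_le_iff.mpr hS₀K
  have hK₀K₁ : IntermediateField.adjoin ℚ S₀ ≤ K₁ := IntermediateField.adjoin.mono ℚ _ _ hS₀S
  set f₀ : IntermediateField.adjoin ℚ S₀ →ₐ[ℚ] ℂ :=
    (τ.comp (IntermediateField.inclusion hK₀K).toRingHom).toRatAlgHom with hf₀
  obtain ⟨σ, hσ⟩ := IntermediateField.exists_algHom_adjoin_of_splits hSint f₀ hK₀K₁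
  have hσ_p : ∀ (p : ℕ) (hp : p.Prime) (hpN : ¬ p ∣ N),
      σ ⟨lam (haveI : NeZero p := ⟨hp.ne_zero⟩; heckeT (Gamma1 N) k p), hlamK _ (hTmem p hp hpN)⟩ =
        τ ⟨heckeEigenvalue f p, hK p hp hpN⟩ := by
    intro p hp hpN
    have hmem₀ : heckeEigenvalue f p ∈ IntermediateField.adjoin ℚ S₀ :=
      IntermediateField.subset_adjoin ℚ S₀ ⟨p, hp, hpN, rfl⟩
    have h1 : (⟨lam (haveI : NeZero p := ⟨hp.ne_zero⟩; heckeT (Gamma1 N) k p),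
        hlamK _ (hTmem p hp hpN)⟩ : K₁) =
        IntermediateField.inclusion hK₀K₁ ⟨heckeEigenvalue f p, hmem₀⟩ :=
      Subtype.ext (hlam_p p hp hpN)
    rw [h1, ← AlgHom.comp_apply, hσ]
    rfl
  -- transport of the eigenvector `f` along `σ`
  set b := integralBasis N k hspan with hb
  have hrat : ∀ T ∈ 𝒯, ∀ i j, ∃ q : ℚ, b.repr (T (b j)) i = q := fun T hT i j ↦ by
    obtain ⟨n, hn⟩ := exists_int_repr_integralBasis hspan T (hstab T hT) i j
    exact ⟨n, by rw [hn, Rat.cast_intCast]⟩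
  obtain ⟨g, hg0, hg⟩ :=
    LatticeEigen.exists_eigenvector_conj b 𝒯 hrat K₁ σ.toRingHom hf0 lam hlamK hlam_eig
  -- the conjugate character `ε' = σ ∘ ε`
  have hne : ∀ d : (ZMod N)ˣ,
      σ.toRingHom ⟨lam (diamondOp N k (d : ZMod N)), hlamK _ (hdmem d)⟩ ≠ 0 := by
    intro d h
    rw [map_eq_zero_iff _ σ.toRingHom.injective] at h
    have h' : lam (diamondOp N k (d : ZMod N)) = 0 := congrArg Subtype.val h
    rw [hlam_d, ← MulChar.coe_toUnitHom] at h'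
    exact (ε.toUnitHom d).ne_zero h'
  set ψ : (ZMod N)ˣ →* ℂˣ :=
    { toFun := fun d ↦ Units.mk0 _ (hne d)
      map_one' := by
        ext
        have h1 : (⟨lam (diamondOp N k ((1 : (ZMod N)ˣ) : ZMod N)), hlamK _ (hdmem 1)⟩ : K₁) = 1 := by
          apply Subtype.ext
          change lam (diamondOp N k ((1 : (ZMod N)ˣ) : ZMod N)) = ((1 : K₁) : ℂ)
          rw [hlam_d, Units.val_one, map_one, OneMemClass.coe_one]
        rw [Units.val_mk0, Units.val_one (α := ℂ), h1, map_one]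
      map_mul' := fun d e ↦ by
        ext
        have h1 : (⟨lam (diamondOp N k ((d * e : (ZMod N)ˣ) : ZMod N)), hlamK _ (hdmem (d * e))⟩ : K₁) =
            ⟨lam (diamondOp N k (d : ZMod N)), hlamK _ (hdmem d)⟩ *
              ⟨lam (diamondOp N k (e : ZMod N)), hlamK _ (hdmem e)⟩ := by
          apply Subtype.ext
          change lam (diamondOp N k ((d * e : (ZMod N)ˣ) : ZMod N)) =
            lam (diamondOp N k (d : ZMod N)) * lam (diamondOp N k (e : ZMod N))
          rw [hlam_d, hlam_d, hlam_d, Units.val_mul, map_mul]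
        rw [Units.val_mul (α := ℂ), Units.val_mk0, Units.val_mk0, Units.val_mk0, h1, map_mul] }
    with hψ
  refine ⟨MulChar.ofUnitHom ψ, g, ?_, hg0, fun p hp hpN ↦ ?_⟩
  · rw [mem_nebentypusSubspace_iff_diamondOp]
    intro d
    rw [hg _ (hdmem d), MulChar.ofUnitHom_coe]
    rfl
  · rw [hg _ (hTmem p hp hpN)]
    congr 1
    exact hσ_p p hp hpN

/-! ### Prop. 5.5 at one level, from Prop. 5.1 and (2.7.2) in weight one at that level -/

open Classical in
/-- **Deligne–Serre 1974, Prop. 5.5 at the level `N`, from Prop. 5.1 and (2.7.2) at `(N, 1)`**: for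
a non-zero cusp form `f` of type `(1, ε)` on `Γ₀(N)`, eigen for the `T_p`, `p ∤ N`, and `η > 0`,
there are a set of primes `X_η` with `dens.sup X_η ≤ η` and a finite `Y_η ⊂ ℂ` with `a_p ∈ Y_η` for
all primes `p ∉ X_η`, `p ∤ N` (the printed proof, p. 520, exactly as in `prop55_of`, with (2.7.3),
(2.7.4) supplied at the level `N` by the two theorems above).
[cite: DeligneSerreASENS1974, Prop. 5.5] -/
theorem prop55_at_of_span_integralLattice1_one (h51 : prop51)
    (hL : DeligneSerre1974_span_integralLattice1 N 1)
    (ε : DirichletCharacter ℂ N) (f : CuspForm (Gamma1 N) 1) (hfε : f ∈ nebentypusSubspace N 1 ε)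
    (hf0 : f ≠ 0)
    (heigen : ∀ p : ℕ, (hp : p.Prime) → ¬ p ∣ N →
      ∃ a : ℂ, (haveI : NeZero p := ⟨hp.ne_zero⟩; heckeT (Gamma1 N) 1 p f) = a • f)
    (θ : ℝ) (hθ : 0 < θ) :
    ∃ (X : Set ℕ) (Y : Finset ℂ), upperDensity X ≤ θ ∧
      ∀ p : ℕ, p.Prime → ¬ p ∣ N → p ∉ X → heckeEigenvalue f p ∈ Y := by
  -- the number field `K ∋ a_p`
  obtain ⟨K, hKfd, hK⟩ := exists_numberField_of_span_integralLattice1 hL ε f hfε hf0 heigen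
  haveI := hKfd
  haveI : NumberField K := NumberField.mk
  have hKmem : ∀ p : ℕ, p.Prime → ¬ p ∣ N → heckeEigenvalue f p ∈ K := fun p hp hpN ↦
    (hK p hp hpN).1
  -- conjugate eigenforms, one for each embedding `τ : K → ℂ`
  choose ε' g hgε hg0 hgT using fun τ : K →+* ℂ ↦
    exists_conj_eigenform_of_span_integralLattice1 hL ε f hfε hf0 heigen K hKmem τ
  have hgeig : ∀ (τ : K →+* ℂ) (p : ℕ), (hp : p.Prime) → ¬ p ∣ N →
      ∃ a : ℂ, (haveI : NeZero p := ⟨hp.ne_zero⟩; heckeT (Gamma1 N) 1 p (g τ)) = a • g τ :=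
    fun τ p hp hpN ↦ ⟨_, hgT τ p hp hpN⟩
  have hev : ∀ (τ : K →+* ℂ) (p : ℕ) (hp : p.Prime) (hpN : ¬ p ∣ N),
      heckeEigenvalue (g τ) p = τ ⟨heckeEigenvalue f p, hKmem p hp hpN⟩ := by
    intro τ p hp hpN
    haveI : NeZero p := ⟨hp.ne_zero⟩
    exact heckeEigenvalue_eq_of_eq_smul (hg0 τ) (hgT τ p hp hpN)
  -- Rankin's bound for each conjugate form
  have h51τ : ∀ τ : K →+* ℂ, (∀ s : ℝ, 1 < s → Summable (rankinTerm (g τ) s)) ∧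
      ∃ C : ℝ, ∀ᶠ s : ℝ in 𝓝[>] (1 : ℝ),
        ∑' p : ℕ, rankinTerm (g τ) s p ≤ Real.log (1 / (s - 1)) + C := by
    intro τ
    have h := h51 (ε' τ) (g τ) (hgε τ) (hg0 τ) (hgeig τ)
    simp only [Int.cast_one] at h
    exact h
  choose hsum C hC using h51τ
  -- the constants
  set r : ℕ := Fintype.card (K →+* ℂ) with hr
  have hrpos : 0 < r := Fintype.card_pos_iff.mpr ⟨(algebraMap K ℂ : K →+* ℂ)⟩
  set c : ℝ := r / θ with hc
  have hcpos : 0 < c := div_pos (Nat.cast_pos.mpr hrpos) hθ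
  -- the exceptional set `X(c)` and the finite set `Y(c)`
  obtain ⟨X, hXmem⟩ : ∃ X : Set ℕ, ∀ p : ℕ, p ∈ X ↔ ∃ (hp : p.Prime) (hpN : ¬ p ∣ N),
      ∃ τ : K →+* ℂ, c < ‖τ ⟨heckeEigenvalue f p, hKmem p hp hpN⟩‖ ^ 2 :=
    ⟨{p | ∃ (hp : p.Prime) (hpN : ¬ p ∣ N), ∃ τ : K →+* ℂ,
      c < ‖τ ⟨heckeEigenvalue f p, hKmem p hp hpN⟩‖ ^ 2}, fun p ↦ Iff.rfl⟩
  have hYfin := NumberField.Embeddings.finite_of_norm_le K ℂ (Real.sqrt c)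
  set Y : Finset ℂ := (hYfin.image (fun x : K ↦ (x : ℂ))).toFinset with hY
  refine ⟨X, Y, ?_, fun p hp hpN hpX ↦ ?_⟩
  swap
  · -- `a_p ∈ Y(c)` for `p ∉ X(c)`
    rw [hY, Set.Finite.mem_toFinset]
    refine ⟨⟨heckeEigenvalue f p, hKmem p hp hpN⟩, ⟨?_, fun φ ↦ ?_⟩, rfl⟩
    · exact (isIntegral_algHom_iff (algebraMap K ℂ).toIntAlgHom (algebraMap K ℂ).injective).mp
        (hK p hp hpN).2
    · have hle : ‖φ ⟨heckeEigenvalue f p, hKmem p hp hpN⟩‖ ^ 2 ≤ c := by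
        by_contra h
        exact hpX ((hXmem p).mpr ⟨hp, hpN, φ, lt_of_not_ge h⟩)
      rw [← Real.sqrt_le_sqrt_iff hcpos.le, Real.sqrt_sq (norm_nonneg _)] at hle
      exact hle
  -- the density estimate
  have hterm : ∀ (s : ℝ) (p : ℕ),
      c * (if p.Prime ∧ p ∈ X then (p : ℝ) ^ (-s) else 0) ≤
        ∑ τ : K →+* ℂ, rankinTerm (g τ) s p := by
    intro s p
    by_cases hpp : p.Prime ∧ p ∈ X
    · rw [if_pos hpp]
      obtain ⟨hp, hpX⟩ := hpp
      obtain ⟨hp', hpN, τ, hτ⟩ := (hXmem p).mp hpX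
      have h1 : c * (p : ℝ) ^ (-s) ≤ rankinTerm (g τ) s p := by
        rw [rankinTerm, if_pos ⟨hp, hpN⟩, hev τ p hp hpN]
        exact mul_le_mul_of_nonneg_right hτ.le (Real.rpow_nonneg (Nat.cast_nonneg p) _)
      exact h1.trans (Finset.single_le_sum (fun τ' _ ↦ rankinTerm_nonneg (g τ') s p)
        (Finset.mem_univ τ))
    · rw [if_neg hpp, mul_zero]
      exact Finset.sum_nonneg fun τ _ ↦ rankinTerm_nonneg (g τ) s p
  have hbound : ∀ᶠ s : ℝ in 𝓝[>] (1 : ℝ),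
      (∑' p : ℕ, (if p.Prime ∧ p ∈ X then (p : ℝ) ^ (-s) else 0)) / Real.log (1 / (s - 1)) ≤
        r / c + (∑ τ, C τ) / c / Real.log (1 / (s - 1)) := by
    have hall : ∀ᶠ s : ℝ in 𝓝[>] (1 : ℝ), ∀ τ : K →+* ℂ,
        ∑' p : ℕ, rankinTerm (g τ) s p ≤ Real.log (1 / (s - 1)) + C τ :=
      eventually_all.mpr fun τ ↦ hC τ
    filter_upwards [hall, LFunctions.PrimeSum.eventually_log_pos,
      LFunctions.PrimeSum.eventually_one_lt] with s hs hlog hs1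
    have h1 : c * ∑' p : ℕ, (if p.Prime ∧ p ∈ X then (p : ℝ) ^ (-s) else 0) ≤
        ∑ τ, ∑' p : ℕ, rankinTerm (g τ) s p := by
      rw [← tsum_mul_left, ← Summable.tsum_finsetSum (fun τ _ ↦ hsum τ s hs1)]
      exact Summable.tsum_le_tsum (hterm s) ((LFunctions.PrimeSum.summable X hs1).mul_left c)
        (summable_sum fun τ _ ↦ hsum τ s hs1)
    have h2 : ∑ τ, ∑' p : ℕ, rankinTerm (g τ) s p ≤ r * Real.log (1 / (s - 1)) + ∑ τ, C τ := by
      calc ∑ τ, ∑' p : ℕ, rankinTerm (g τ) s p ≤ ∑ τ : K →+* ℂ, (Real.log (1 / (s - 1)) + C τ) :=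
            Finset.sum_le_sum fun τ _ ↦ hs τ
        _ = r * Real.log (1 / (s - 1)) + ∑ τ, C τ := by
            rw [Finset.sum_add_distrib, Finset.sum_const, Finset.card_univ, nsmul_eq_mul, hr]
    have h3 := h1.trans h2
    have hc0 : c ≠ 0 := hcpos.ne'
    have hL0 : Real.log (1 / (s - 1)) ≠ 0 := hlog.ne'
    have h4 : ∑' p : ℕ, (if p.Prime ∧ p ∈ X then (p : ℝ) ^ (-s) else 0) ≤
        (r * Real.log (1 / (s - 1)) + ∑ τ, C τ) / c := by
      rw [le_div_iff₀ hcpos]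
      linarith [h3]
    calc (∑' p : ℕ, (if p.Prime ∧ p ∈ X then (p : ℝ) ^ (-s) else 0)) / Real.log (1 / (s - 1))
        ≤ ((r * Real.log (1 / (s - 1)) + ∑ τ, C τ) / c) / Real.log (1 / (s - 1)) :=
          div_le_div_of_nonneg_right h4 hlog.le
      _ = r / c + (∑ τ, C τ) / c / Real.log (1 / (s - 1)) := by
          field_simp
  have hlim : Tendsto (fun s : ℝ ↦ (r : ℝ) / c + (∑ τ, C τ) / c / Real.log (1 / (s - 1)))
      (𝓝[>] (1 : ℝ)) (𝓝 ((r : ℝ) / c)) := by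
    have := (tendsto_const_nhds (x := (∑ τ, C τ) / c)).div_atTop
      LFunctions.PrimeSum.tendsto_log_one_div_sub_one
    simpa using this.const_add ((r : ℝ) / c)
  have hrc : (r : ℝ) / c = θ := by
    have hr0 : (r : ℝ) ≠ 0 := (Nat.cast_pos.mpr hrpos).ne'
    rw [hc]
    field_simp
  calc upperDensity X
      ≤ limsup (fun s : ℝ ↦ (r : ℝ) / c + (∑ τ, C τ) / c / Real.log (1 / (s - 1)))
          (𝓝[>] (1 : ℝ)) := by
        unfold upperDensity
        refine limsup_le_limsup hbound ?_ hlim.isBoundedUnder_le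
        exact (isBoundedUnder_of_eventually_ge
          (LFunctions.PrimeSum.eventually_div_log_nonneg X)).isCoboundedUnder_le
    _ = θ := by rw [hlim.limsup_eq, hrc]

/-! ### Assembly: Prop. 5.5 from inputs at the levels `N ≥ 5` only -/

/-- **Prop. 5.5 from (2.7.2) in weight one at every level `N ≥ 5`** (`prop51` is the theorem
`prop51_holds`; at the levels `N ≤ 4` there is no non-zero weight-one cusp form,
`cuspForm_gamma1_weight_one_eq_zero_of_le_four`, so Prop. 5.5 is vacuous there).
[cite: DeligneSerreASENS1974, Prop. 5.5] -/
theorem prop55_of_span_integralLattice1_one_of_five_le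
    (hL : ∀ (N : ℕ) [NeZero N], 5 ≤ N → DeligneSerre1974_span_integralLattice1 N 1) : prop55 := by
  intro N _ ε f hfε hf0 heigen θ hθ
  rcases Nat.lt_or_ge N 5 with hN | hN
  · exact absurd (cuspForm_gamma1_weight_one_eq_zero_of_le_four (by omega) f) hf0
  · exact prop55_at_of_span_integralLattice1_one prop51_holds (hL N hN) ε f hfε hf0 heigen θ hθ

/-- **Prop. 5.5 from (2.7.2) at every level `N ≥ 5` in all sufficiently large weights** (threshold
depending on the level): (2.7.2) descends from the weights `k + 4`, `k + 6` to `k` by division by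
`E₄`, `E₆` (`DeligneSerre1974_span_integralLattice1.of_forall_le`), in particular to weight one
(`.weight_one_of_five_seven`). [cite: DeligneSerreASENS1974, Prop. 5.5, Prop. 2.7 and Rem. 2.8] -/
theorem prop55_of_span_integralLattice1_of_le_of_five_le
    (hL : ∀ (N : ℕ) [NeZero N], 5 ≤ N → ∃ K₀ : ℤ, ∀ k : ℤ, K₀ ≤ k →
      DeligneSerre1974_span_integralLattice1 N k) : prop55 := by
  refine prop55_of_span_integralLattice1_one_of_five_le fun N _ hN ↦ ?_
  obtain ⟨K₀, hK₀⟩ := hL N hN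
  exact DeligneSerre1974_span_integralLattice1.weight_one_of_five_seven
    (DeligneSerre1974_span_integralLattice1.of_forall_le hK₀ 5)
    (DeligneSerre1974_span_integralLattice1.of_forall_le hK₀ 7)

/-- **Prop. 5.5 from a full Hecke-stable real lattice in `S_{n+2}(Γ₁(N))^∨` for every `N ≥ 5` and
all large `n`** (Shimura 1971, (3.5.20); through his Thm. 3.52,
`DeligneSerre1974_span_integralLattice1_of_heckeStableRealLattice`).
[cite: DeligneSerreASENS1974, Prop. 5.5 and Prop. 2.7 (2.7.2)] -/
theorem prop55_of_heckeStableRealLattice_of_five_le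
    (H : ∀ (N : ℕ) [NeZero N], 5 ≤ N → ∃ n₀ : ℕ, ∀ n : ℕ, n₀ ≤ n →
      Nonempty (HeckeStableRealLattice N (n + 2))) : prop55 := by
  refine prop55_of_span_integralLattice1_of_le_of_five_le fun N _ hN ↦ ?_
  obtain ⟨n₀, hn₀⟩ := H N hN
  refine ⟨(n₀ : ℤ) + 2, fun k hk ↦ ?_⟩
  obtain ⟨n, rfl⟩ : ∃ n : ℕ, k = (n : ℤ) + 2 := ⟨(k - 2).toNat, by omega⟩
  obtain ⟨Λ⟩ := hn₀ n (by omega)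
  exact DeligneSerre1974_span_integralLattice1_of_heckeStableRealLattice (by omega) Λ

/-- **Deligne–Serre 1974, Prop. 5.5, from the rank half of the Eichler–Shimura isomorphism for
`Γ₁(N)` at the levels `N ≥ 5` only, in all large weights.**  If for every `N ≥ 5` and all
sufficiently large `n` the period lattice `periodLatticeK1 n ⊆ S_{n+2}(Γ₁(N))^∨` is the `ℤ`-span of
`2 dim_ℂ S_{n+2}(Γ₁(N))` functionals (Shimura 1971, Thm. 8.4 with (8.2.23):
`rank H¹_P(Γ₁(N), Symⁿ ℤ²) = 2 dim S_{n+2}(Γ₁(N))`), then Prop. 5.5 holds: for `n ≥ max n₀ 5` the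
lattice spans `S_{n+2}(Γ₁(N))^∨` over `ℝ` (`periodLatticeK1_span_real_eq_top`), so it is a full
Hecke-stable real lattice (`heckeStableRealLatticeOfGenerators`), and
`prop55_of_heckeStableRealLattice_of_five_le` applies; the levels `N ≤ 4` carry no weight-one cusp
form.  This is the precise remaining input of `prop55_holds` in the tree.
[cite: DeligneSerreASENS1974, Prop. 5.5; Shimura1971, (3.5.20), Thm. 3.52, Thm. 8.4] -/
theorem prop55_of_periodLatticeK1_eq_span_of_five_le
    (H : ∀ (N : ℕ) [NeZero N], 5 ≤ N → ∃ n₀ : ℕ, ∀ n : ℕ, n₀ ≤ n →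
      ∃ g : Fin (2 * Module.finrank ℂ (CuspForm (Gamma1 N) (n + 2))) →
          Module.Dual ℂ (CuspForm (Gamma1 N) (n + 2)),
        (periodLatticeK1 (N := N) n : Set (Module.Dual ℂ (CuspForm (Gamma1 N) (n + 2)))) =
          Submodule.span ℤ (Set.range g)) : prop55 := by
  refine prop55_of_heckeStableRealLattice_of_five_le fun N _ hN ↦ ?_
  obtain ⟨n₀, hn₀⟩ := H N hN
  refine ⟨max n₀ 5, fun n hn ↦ ?_⟩
  obtain ⟨g, hg⟩ := hn₀ n ((le_max_left n₀ 5).trans hn)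
  exact ⟨heckeStableRealLatticeOfGenerators ((le_max_right n₀ 5).trans hn) g hg⟩

end DeligneSerre1974

end Literature.NumberTheory.EllipticCurves.ModularForms
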